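import Summits.QuantumFields.BalabanUV.Beta.GAN24.LatticeKernelDiagonal
import Summits.QuantumFields.BalabanUV.Beta.GAN24.StripRegularBiLocAlgebra

/-!
# `BalabanUV.Beta.GAN24.LatticeKernelVertex` — binder row G-an2-4 / (CONV-C), STENCIL slot, campaign «E3Shape» (`SKELETON-S3.md` nodes S3-L1 ∕ S3-L3(a),
# ANALYSIS HALF, part 5): THE VERTEX PATTERN — a kernel-weighted sum of TRANSLATED finite stencils `Σ'_u K[H](u − c) · T_u(x, z)` (an2's
# `vertexOf S μ y = Σ'_u wH(u − N•y) • S u`) IS ONE two-momentum kernel, with bi-symbol `H(p + q) · Σ_{(s,s′)} t(s,s′) e^{−i(p·(s+c) + q·(s′+c))}`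

NOT IN PRINT; OUR BOOKKEEPING (engine «LK-CONV*» part 5, CLAIMS l.4153 ∕ l.4206 ∕ l.4419; row owner gan24-p1-g3 RULINGS-2 l.4221 ∕ RULINGS-3 l.4365; unit
b2b-balaban-gan24-formalise-leaf-07, gen 9).  HONEST FRAMING (cell contract, verbatim): «discharging `BetaPertH` makes Bałaban's UV stability UNCONDITIONAL —
a real constructive-QFT result; it is NOT the continuum limit and NOT the Clay problem.»  HONEST DEPENDENCY (verbatim): «continuum YM on T⁴ ⇐ BetaPertH ∧
nine spine estimates (0/9 proved); BetaPertH ⇐ (D1) ∧ (D4) ∧ CAP+tail; G-an2-4 gates asym, D1 and NE2/3/4.»  [folklore] Fourier analysis on `ℤ^{d+1}`: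
cites nothing, mints no `def … : Prop`, asserts no statement of Bałaban's, instantiates no wall binder.  NOT summit progress.

## Why (context only; asserted nowhere below)

S3-L3 has to write the vertex `V = vertexOf_N (Sc n) κ′ u′ = Σ_{κ″} Σ'_u wH_N κ″ κ′ (u − N•u′) • Sc n κ″ u` as a two-momentum kernel `K₂[𝒱̂]`.  Each
`Sc n κ″ u` is a FINITE-RANGE stencil translated to `u` (leaf-17's `PushSumNest.Sc_succ_closed`), and the weight `u ↦ wH_N(u − c)` is (the real part of)
a one-momentum lattice kernel of a globally periodic strip-regular symbol (road P1's `fibInv`, reality «KKT-REAL*»).  THIS FILE proves the generic identity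
behind that step: with `T_u(x, z) = Σ_{(s,s′) ∈ S} t(s,s′) [x = u + s] [z = u + s′]`,
`Σ'_u K[H](u − c) · T_u(x, z) = K₂[(p, q) ↦ (Σ_{(s,s′)} t(s,s′) e^{i p·(−(s+c))} e^{i q·(−(s′+c))}) · H(p + q)](x, z)`
— the diagonal lemma (`LatticeKernelDiagonal.latticeKernel₂_shear`: momentum conservation at the vertex) and leaf-14's phase rules
(`StripRegularBiLocAlgebra.latticeKernel₂_phase_left∕right`, `latticeKernel₂_sum_mul`).

## Contents (all [folklore]; `hper : ∀ i p, H (Function.update p i (p i + 2π)) = H p`)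
§1 the finite-support bookkeeping: `tsum_mul_indicator_pair` (`Σ'_u K(u − c)·[x = u+s][z = u+s′] = [x − s = z − s′]·K(x − s − c)`).
§2 `stripRegular_joint_cphase_zero` (a two-leg character is jointly strip regular of half-width `0` with bound `1`), `stripRegular_joint_vertexTerm`,
   `latticeKernel₂_vertexTerm` (one translated delta: phases + the diagonal lemma).
§3 **`tsum_latticeKernel_mul_stencil`**: the vertex pattern as ONE two-momentum kernel.
NOT BetaPertH, NOT continuum, NOT Clay.
-/

noncomputable section

open Complex Set MeasureTheory Filter Topology
open Literature.MathematicalPhysics.QuantumFieldTheory.Balaban1983to89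
open B4Strip (ofRealVec Strip reVec)
open B4ContourShift (BZ latticeKernel StripRegular ofRealVec_mem_Strip openRect phase)
open B4Green244 (phaseC)
open Beta.FibreInverseDecay (cphase cphase_eq_phaseC StripHolo)
open Summit.QuantumFields.BalabanUV.Beta.GAN24.LatticeKernelConvolution (stripRegular_nonneg)
open Summit.QuantumFields.BalabanUV.Beta.GAN24.LatticeKernelConvolutionTwo (openRect_zero ofRealVec_reVec_of_mem_Strip_zero)
open Summit.QuantumFields.BalabanUV.Beta.GAN24.LatticeKernelDiagonal (stripRegular_joint_shear latticeKernel₂_shear)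
open Summit.QuantumFields.BalabanUV.Beta.GAN24.StripRegularRestrict (inl2 inr2 pair pair_inl pair_inr inl2_or_inr2 fstC sndC fstC_apply sndC_apply
  fstC_pair sndC_pair joint joint_apply joint_pair ofRealVec_pair)
open Summit.QuantumFields.BalabanUV.Beta.GAN24.StripRegularBiLoc (latticeKernel₂ stripHolo_joint_cphase stripRegular_of_stripHolo)
open Summit.QuantumFields.BalabanUV.Beta.GAN24.StripRegularBiLocAlgebra (latticeKernel₂_phase_left latticeKernel₂_phase_right latticeKernel₂_sum_mul)
open scoped Real Classical

namespace Summit.QuantumFields.BalabanUV.Beta.GAN24.LatticeKernelVertex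

variable {d : ℕ}

/-! ## §1 Finite-support bookkeeping -/

/-- [folklore] the translated one-point stencil against a kernel weight: only `u = x − s` contributes. -/
theorem tsum_mul_indicator_pair (K : (Fin (d + 1) → ℤ) → ℂ) (c s s' x z : Fin (d + 1) → ℤ) :
    ∑' u, K (u - c) * (if x = u + s ∧ z = u + s' then (1 : ℂ) else 0) =
      if x - s = z - s' then K (x - s - c) else 0 := by
  rw [tsum_eq_single (x - s)]
  · by_cases h : x - s = z - s'
    · rw [if_pos h, if_pos ⟨by abel, by rw [h]; abel⟩, mul_one]
    · rw [if_neg h, if_neg, mul_zero]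
      rintro ⟨_, h2⟩
      exact h (by rw [h2]; abel)
  · intro u hu
    rw [if_neg, mul_zero]
    rintro ⟨h1, _⟩
    exact hu (by rw [h1]; abel)

/-- [folklore] the summand has finite support in `u` (at most the point `x − s`), hence is summable. -/
theorem summable_mul_indicator_pair (K : (Fin (d + 1) → ℤ) → ℂ) (c s s' x z : Fin (d + 1) → ℤ) :
    Summable fun u => K (u - c) * (if x = u + s ∧ z = u + s' then (1 : ℂ) else 0) := by
  refine summable_of_ne_finset_zero (s := {x - s}) fun u hu => ?_
  rw [Finset.mem_singleton] at hu
  rw [if_neg, mul_zero]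
  rintro ⟨h1, _⟩
  exact hu (by rw [h1]; abel)

/-! ## §2 One translated delta as a two-momentum kernel -/

section Term

variable {H : (Fin (d + 1) → ℂ) → ℂ} {κ M : ℝ}

/-- [folklore] a two-leg character `e^{ip·a} e^{iq·b}` is jointly strip regular of half-width `0` with bound `1` (modulus one on the real zone). -/
theorem stripRegular_joint_cphase_zero (a b : Fin (d + 1) → ℤ) :
    StripRegular (joint fun p q => cphase a p * cphase b q) 0 1 := by
  refine stripRegular_of_stripHolo (stripHolo_joint_cphase a b 0) fun P hP => ?_
  rw [joint_apply, ← ofRealVec_reVec_of_mem_Strip_zero hP]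
  have e1 : fstC (ofRealVec (reVec P)) = ofRealVec (fun i => reVec P (inl2 i)) := by funext i; simp [fstC_apply, ofRealVec]
  have e2 : sndC (ofRealVec (reVec P)) = ofRealVec (fun i => reVec P (inr2 i)) := by funext i; simp [sndC_apply, ofRealVec]
  rw [e1, e2, cphase_eq_phaseC, cphase_eq_phaseC, B4Green244.phaseC_ofRealVec, B4Green244.phaseC_ofRealVec, norm_mul,
    B4ContourShift.norm_cexp_phase, B4ContourShift.norm_cexp_phase, mul_one]

/-- [folklore] one term of the vertex bi-symbol, `e^{ip·σ} (e^{iq·τ} H(p+q))`, is jointly strip regular of half-width `0` with bound `M`. -/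
theorem stripRegular_joint_vertexTerm (h : StripRegular H κ M) (hκ : 0 ≤ κ)
    (hper : ∀ (i : Fin (d + 1)) (p : Fin (d + 1) → ℂ), H (Function.update p i (p i + 2 * π)) = H p) (σ τ : Fin (d + 1) → ℤ) :
    StripRegular (joint fun p q => cphase σ p * (cphase τ q * H (p + q))) 0 (1 * M) := by
  have h1 := (stripRegular_joint_cphase_zero σ τ).mul (stripRegular_joint_shear h hκ hper) zero_le_one
  have e : (joint fun p q => cphase σ p * (cphase τ q * H (p + q))) =
      fun P => (joint fun p q => cphase σ p * cphase τ q) P * (joint fun p q => H (p + q)) P := by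
    funext P; simp only [joint_apply]; ring
  rw [e]
  exact h1

/-- [folklore] **ONE TRANSLATED DELTA**: `K₂[e^{−ip·(s+c)} e^{−iq·(s′+c)} H(p+q)](x, z) = [x − s = z − s′] · K[H](x − s − c)` (phases translate both legs,
then the diagonal lemma). -/
theorem latticeKernel₂_vertexTerm (h : StripRegular H κ M) (hκ : 0 ≤ κ)
    (hper : ∀ (i : Fin (d + 1)) (p : Fin (d + 1) → ℂ), H (Function.update p i (p i + 2 * π)) = H p) (c s s' x z : Fin (d + 1) → ℤ) :
    latticeKernel₂ (fun p q => cphase (-(s + c)) p * (cphase (-(s' + c)) q * H (p + q))) x z =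
      if x - s = z - s' then latticeKernel H (x - s - c) else 0 := by
  have e1 : (fun p q => cphase (-(s + c)) p * (cphase (-(s' + c)) q * H (p + q))) =
      fun p q => cexp (I * phaseC p (-(s + c))) * (cexp (I * phaseC q (-(s' + c))) * H (p + q)) := by
    funext p q; rw [cphase_eq_phaseC, cphase_eq_phaseC]
  rw [e1, latticeKernel₂_phase_left, latticeKernel₂_phase_right (fun p q => H (p + q)), latticeKernel₂_shear h hκ hper]
  have e2 : (x + -(s + c) = z + -(s' + c)) ↔ (x - s = z - s') := by
    rw [show x + -(s + c) = (x - s) - c by abel, show z + -(s' + c) = (z - s') - c by abel, sub_left_inj]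
  by_cases hxz : x - s = z - s'
  · rw [if_pos (e2.mpr hxz), if_pos hxz]
    congr 1; abel
  · rw [if_neg (fun h0 => hxz (e2.mp h0)), if_neg hxz]

end Term

/-! ## §3 The vertex pattern -/

section Vertex

variable {H : (Fin (d + 1) → ℂ) → ℂ} {κ M : ℝ}

/-- [folklore] **THE VERTEX PATTERN AS ONE TWO-MOMENTUM KERNEL**: for a strip-regular (`κ ≥ 0`), globally `2π`-periodic weight symbol `H`, a finite
coefficient table `t` on `S ⊆ ℤ^{d+1} × ℤ^{d+1}` and a base point `c`,
`Σ'_u K[H](u − c) · (Σ_{(s,s′)∈S} t(s,s′) [x = u + s][z = u + s′]) = K₂[(p,q) ↦ Σ_{(s,s′)∈S} t(s,s′) · e^{ip·(−(s+c))} (e^{iq·(−(s′+c))} H(p+q))](x, z)`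
— an2's `vertexOf` shape (`Σ'_u wH(u − N•y) • S u`, `S u` a finite stencil at `u`) with bi-symbol «T̂(p,q) · Ĥ(p+q)» up to the base-point phase. -/
theorem tsum_latticeKernel_mul_stencil (h : StripRegular H κ M) (hκ : 0 ≤ κ)
    (hper : ∀ (i : Fin (d + 1)) (p : Fin (d + 1) → ℂ), H (Function.update p i (p i + 2 * π)) = H p)
    (S : Finset ((Fin (d + 1) → ℤ) × (Fin (d + 1) → ℤ))) (t : (Fin (d + 1) → ℤ) × (Fin (d + 1) → ℤ) → ℂ) (c x z : Fin (d + 1) → ℤ) :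
    ∑' u, latticeKernel H (u - c) * (∑ st ∈ S, t st * (if x = u + st.1 ∧ z = u + st.2 then (1 : ℂ) else 0)) =
      latticeKernel₂ (fun p q => ∑ st ∈ S, t st * (cphase (-(st.1 + c)) p * (cphase (-(st.2 + c)) q * H (p + q)))) x z := by
  -- left: exchange the finite sum with the `u`-sum and evaluate each translated delta
  have e1 : ∀ u, latticeKernel H (u - c) * (∑ st ∈ S, t st * (if x = u + st.1 ∧ z = u + st.2 then (1 : ℂ) else 0)) =
      ∑ st ∈ S, t st * (latticeKernel H (u - c) * (if x = u + st.1 ∧ z = u + st.2 then (1 : ℂ) else 0)) := by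
    intro u; rw [Finset.mul_sum]; refine Finset.sum_congr rfl fun st _ => ?_; ring
  have L : ∑' u, latticeKernel H (u - c) * (∑ st ∈ S, t st * (if x = u + st.1 ∧ z = u + st.2 then (1 : ℂ) else 0)) =
      ∑ st ∈ S, t st * (if x - st.1 = z - st.2 then latticeKernel H (x - st.1 - c) else 0) := by
    calc ∑' u, latticeKernel H (u - c) * (∑ st ∈ S, t st * (if x = u + st.1 ∧ z = u + st.2 then (1 : ℂ) else 0))
        = ∑' u, ∑ st ∈ S, t st * (latticeKernel H (u - c) * (if x = u + st.1 ∧ z = u + st.2 then (1 : ℂ) else 0)) :=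
          tsum_congr e1
      _ = ∑ st ∈ S, ∑' u, t st * (latticeKernel H (u - c) * (if x = u + st.1 ∧ z = u + st.2 then (1 : ℂ) else 0)) :=
          Summable.tsum_finsetSum
            (f := fun st u => t st * (latticeKernel H (u - c) * (if x = u + st.1 ∧ z = u + st.2 then (1 : ℂ) else 0)))
            (fun st _ => (summable_mul_indicator_pair (latticeKernel H) c st.1 st.2 x z).mul_left (t st))
      _ = ∑ st ∈ S, t st * (if x - st.1 = z - st.2 then latticeKernel H (x - st.1 - c) else 0) :=
          Finset.sum_congr rfl fun st _ => by rw [tsum_mul_left, tsum_mul_indicator_pair]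
  -- right: linearity, then one translated delta at a time
  have R : latticeKernel₂ (fun p q => ∑ st ∈ S, t st * (cphase (-(st.1 + c)) p * (cphase (-(st.2 + c)) q * H (p + q)))) x z =
      ∑ st ∈ S, t st * latticeKernel₂ (fun p q => cphase (-(st.1 + c)) p * (cphase (-(st.2 + c)) q * H (p + q))) x z :=
    latticeKernel₂_sum_mul S t (fun st p q => cphase (-(st.1 + c)) p * (cphase (-(st.2 + c)) q * H (p + q)))
      (fun st _ => stripRegular_joint_vertexTerm h hκ hper _ _) le_rfl x z
  rw [L, R]
  refine Finset.sum_congr rfl fun st _ => ?_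
  rw [latticeKernel₂_vertexTerm h hκ hper]

end Vertex

end Summit.QuantumFields.BalabanUV.Beta.GAN24.LatticeKernelVertex

end
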